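import Literature.Probability.Percolation.CollarWindowBound
import Literature.Probability.Percolation.SeededSymmetry
import HarnessLib

/-!
# Collar windows in every orientation: transporting the three-arm bound by lattice symmetries

Topic `Probability/Percolation`.  `CollarWindowBound.lean` bounds the probability of the two bad
patterns of the collar exploration in a straight window of the inner boundary `β'` when the collar
lies ABOVE a horizontal boundary segment (`CleanWindow`).  The inner boundary of a rectilinear collar
also has segments with the collar below, to the left, or to the right.  Here a collar datum `𝒞` is
transported by a lattice symmetry `ψ` (`SeededSymmetry.lean`); if the transported datum `𝒞.map ψ`
has a clean window in standard position, the bad patterns of `𝒞` AT THAT WINDOW — defined as the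
pull-back of the standard patterns of `𝒞.map ψ`, and described in terms of the exploration of `𝒞`
itself by `mem_patternOneAt_iff` / `mem_patternTwoAt_iff` (order independence of the exploration,
`Seeded.LatticeSym.examined_map`) — have probability at most `16 · P_{1/2}(threeArm j m R)`, by the
invariance of `P_{1/2}` under `ψ` (Schramm–Smirnov's Lemma 6.2 "applied to all components of `K`",
Ann. Probab. 39 (2011), §4, proof of Prop. 4.1).

* `Seeded.CollarDatum.map` — the transported collar datum; `map_A`, `map_D₀`, `map_seeds`;
* `patternOneAt`, `patternTwoAt` — the bad patterns of `𝒞` at a `ψ`-window;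
  `mem_patternOneAt_iff`, `mem_patternTwoAt_iff`;
* **`real_patternAt_le`** — `P_{1/2}(Q1_ψ ∪ Q2_ψ) ≤ 16 · P_{1/2}(threeArm j m R)`.

Everything is proved; no named fact is introduced.

## References

* O. Schramm, S. Smirnov, Ann. Probab. 39 (2011) 1768–1814, arXiv:1101.5820, §4 and Lemma 6.2.
  [SchrammSmirnov2011]
* G. Grimmett, *Percolation*, 2nd ed. (1999), §1.6 (lattice symmetries of `P_p`). [GrimmettPercolation1999]
-/

noncomputable section

open MeasureTheory Set SimpleGraph

namespace Literature.Probability.Percolation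

open LatticeModels Relation Z2HalfPlane
open scoped Classical

namespace Seeded

namespace CollarDatum

variable (𝒞 : CollarDatum) (ψ : LatticeSym)

/-! ### Transporting a collar datum -/

/-- **The transported collar datum** `(σ K, σ Far)`. [folklore] -/
def map : CollarDatum where
  K := 𝒞.K.map ψ.σ.toEmbedding
  Far := ψ.σ '' 𝒞.Far
  disjoint v hv hF := by
    rw [Finset.mem_map_equiv] at hv
    obtain ⟨w, hw, hwv⟩ := hF
    have : w = ψ.σ.symm v := by rw [← hwv, Equiv.symm_apply_apply]
    exact 𝒞.disjoint _ hv (this ▸ hw)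

variable {𝒞 ψ}

/-- Sites of the transported strip. [folklore] -/
theorem mem_map_K_iff {v : Site 2} : ψ.σ v ∈ (𝒞.map ψ).K ↔ v ∈ 𝒞.K := by
  simp [map]

/-- Far sites of the transported datum. [folklore] -/
theorem mem_map_Far_iff {v : Site 2} : ψ.σ v ∈ (𝒞.map ψ).Far ↔ v ∈ 𝒞.Far := by
  simp only [map, Set.mem_image]
  exact ⟨fun ⟨w, hw, hwv⟩ => ψ.σ.injective hwv ▸ hw, fun h => ⟨v, h, rfl⟩⟩

/-- **Examinable edges are transported.** [folklore] -/
theorem mem_map_A_iff {e : Sym2 (Site 2)} : ψ.edgeEquiv e ∈ (𝒞.map ψ).A ↔ e ∈ 𝒞.A := by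
  rw [mem_A_iff, mem_A_iff, ψ.mem_edgeSet_iff]
  refine and_congr_right fun _ => and_congr ?_ ?_
  · constructor
    · rintro ⟨v', hv', hK⟩
      obtain ⟨v, hv, rfl⟩ : ∃ v ∈ e, ψ.σ v = v' := by
        rw [sym2Equiv_apply, Sym2.mem_map] at hv'; exact hv'
      exact ⟨v, hv, mem_map_K_iff.1 hK⟩
    · rintro ⟨v, hv, hK⟩
      exact ⟨ψ.σ v, by rw [sym2Equiv_apply, Sym2.mem_map]; exact ⟨v, hv, rfl⟩, mem_map_K_iff.2 hK⟩
  · constructor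
    · intro h v hv
      have := h (ψ.σ v) (by rw [sym2Equiv_apply, Sym2.mem_map]; exact ⟨v, hv, rfl⟩)
      rwa [mem_map_K_iff, mem_map_Far_iff] at this
    · intro h v' hv'
      obtain ⟨v, hv, rfl⟩ : ∃ v ∈ e, ψ.σ v = v' := by
        rw [sym2Equiv_apply, Sym2.mem_map] at hv'; exact hv'
      rw [mem_map_K_iff, mem_map_Far_iff]
      exact h v hv

/-- The examinable edge sets correspond as finite sets. [folklore] -/
theorem map_A : (𝒞.map ψ).A = 𝒞.A.map ψ.edgeEquiv.toEmbedding := by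
  ext e'
  obtain ⟨e, rfl⟩ := ψ.edgeEquiv.surjective e'
  rw [mem_map_A_iff, LatticeSym.mem_map_iff]

/-- **Seed faces are transported.** [folklore] -/
theorem mem_map_D₀_iff {f : Site 2} : ψ.σF f ∈ (𝒞.map ψ).D₀ ↔ f ∈ 𝒞.D₀ := by
  simp only [D₀, Set.mem_setOf_eq]
  constructor
  · rintro ⟨v', hv', hF⟩
    obtain ⟨v, rfl⟩ := ψ.σ.surjective v'
    exact ⟨v, (ψ.touches_iff v f).1 hv', mem_map_Far_iff.1 hF⟩
  · rintro ⟨v, hv, hF⟩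
    exact ⟨ψ.σ v, (ψ.touches_iff v f).2 hv, mem_map_Far_iff.2 hF⟩

/-- The seed faces correspond as sets. [folklore] -/
theorem map_D₀ : (𝒞.map ψ).D₀ = ψ.σF '' 𝒞.D₀ := by
  ext f'
  obtain ⟨f, rfl⟩ := ψ.σF.surjective f'
  rw [mem_map_D₀_iff, Set.mem_image]
  exact ⟨fun h => ⟨f, h, rfl⟩, fun ⟨g, hg, hgf⟩ => ψ.σF.injective hgf ▸ hg⟩

/-- **The seeds of the transported datum are the transported seeds.** [folklore] -/
theorem map_seeds : (𝒞.map ψ).seeds = ψ.mapSeeds 𝒞.seeds := by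
  have hA : (𝒞.map ψ).seeds.A = (ψ.mapSeeds 𝒞.seeds).A := by
    rw [seeds_A, map_A]; rfl
  have hO : (𝒞.map ψ).seeds.O₀ = (ψ.mapSeeds 𝒞.seeds).O₀ := rfl
  have hD : (𝒞.map ψ).seeds.D₀ = (ψ.mapSeeds 𝒞.seeds).D₀ := by
    rw [seeds_D₀, map_D₀]; rfl
  cases h1 : (𝒞.map ψ).seeds with
  | mk A O D hAsub =>
    cases h2 : ψ.mapSeeds 𝒞.seeds with
    | mk A' O' D' hAsub' =>
      rw [h1, h2] at hA hO hD
      simp only at hA hO hD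
      subst hA hO hD
      rfl

/-! ### The bad patterns at an oriented window -/

variable (𝒞 ψ)

/-- **Pattern (Q1) of `𝒞` at the `ψ`-window `[j, j+m)`**: the standard pattern of the transported
datum, pulled back. [cite: SchrammSmirnov2011, §4, proof of Prop. 4.1 with Lemma 6.2] -/
def patternOneAt (j : ℤ) (m : ℕ) : Set (BondConfig (Site 2)) := ψ.relabel ⁻¹' (𝒞.map ψ).patternOne j m

/-- **Pattern (Q2) of `𝒞` at the `ψ`-window `[j, j+m)`.** [cite: SchrammSmirnov2011, §4, proof of Prop. 4.1 with Lemma 6.2] -/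
def patternTwoAt (j : ℤ) (m : ℕ) : Set (BondConfig (Site 2)) := ψ.relabel ⁻¹' (𝒞.map ψ).patternTwo j m

variable {𝒞 ψ}

/-- **Pattern (Q1) at an oriented window, in terms of the exploration of `𝒞` itself**: sites
`σ⁻¹(x,0), σ⁻¹(x',0) ∈ 𝒪`, face `σF⁻¹(b,0) ∈ 𝒟`, and the pulled-back bottom edge not examined-open.
[cite: SchrammSmirnov2011, §4, proof of Prop. 4.1] -/
theorem mem_patternOneAt_iff {j : ℤ} {m : ℕ} {ω : BondConfig (Site 2)} :
    ω ∈ 𝒞.patternOneAt ψ j m ↔ ∃ x b x' : ℤ, (j ≤ x ∧ x ≤ b ∧ b < x' ∧ x' < j + m) ∧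
      OReach 𝒞.seeds (examined 𝒞.seeds ω) ω (ψ.σ.symm ![x, 0]) ∧
      OReach 𝒞.seeds (examined 𝒞.seeds ω) ω (ψ.σ.symm ![x', 0]) ∧
      DReach 𝒞.seeds (examined 𝒞.seeds ω) ω (ψ.σF.symm ![b, 0]) ∧
      ¬ (ψ.edgeEquiv.symm (bottomEdge b) ∈ examined 𝒞.seeds ω ∧ ψ.edgeEquiv.symm (bottomEdge b) ∈ ω) := by
  rw [patternOneAt, Set.mem_preimage, mem_patternOne_iff, map_seeds]
  refine exists_congr fun x => exists_congr fun b => exists_congr fun x' => and_congr_right fun _ => ?_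
  rw [← LatticeSym.oReach_examined_map_iff (ψ := ψ) 𝒞.seeds ω (ψ.σ.symm ![x, 0]),
    ← LatticeSym.oReach_examined_map_iff (ψ := ψ) 𝒞.seeds ω (ψ.σ.symm ![x', 0]),
    ← LatticeSym.dReach_examined_map_iff (ψ := ψ) 𝒞.seeds ω (ψ.σF.symm ![b, 0]),
    ← LatticeSym.mem_examined_map_iff (ψ := ψ) 𝒞.seeds ω, ← ψ.mem_relabel_iff ω]
  simp only [Equiv.apply_symm_apply]

/-- **Pattern (Q2) at an oriented window, in terms of the exploration of `𝒞` itself.**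
[cite: SchrammSmirnov2011, §4, proof of Prop. 4.1] -/
theorem mem_patternTwoAt_iff {j : ℤ} {m : ℕ} {ω : BondConfig (Site 2)} :
    ω ∈ 𝒞.patternTwoAt ψ j m ↔ ∃ b₁ x b₂ : ℤ, (j ≤ b₁ ∧ b₁ < x ∧ x ≤ b₂ ∧ b₂ < j + m) ∧
      OReach 𝒞.seeds (examined 𝒞.seeds ω) ω (ψ.σ.symm ![x, 0]) ∧
      DReach 𝒞.seeds (examined 𝒞.seeds ω) ω (ψ.σF.symm ![b₁, 0]) ∧
      DReach 𝒞.seeds (examined 𝒞.seeds ω) ω (ψ.σF.symm ![b₂, 0]) ∧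
      ¬ (ψ.edgeEquiv.symm (bottomEdge b₁) ∈ examined 𝒞.seeds ω ∧ ψ.edgeEquiv.symm (bottomEdge b₁) ∈ ω) ∧
      ¬ (ψ.edgeEquiv.symm (bottomEdge b₂) ∈ examined 𝒞.seeds ω ∧ ψ.edgeEquiv.symm (bottomEdge b₂) ∈ ω) := by
  rw [patternTwoAt, Set.mem_preimage, mem_patternTwo_iff, map_seeds]
  refine exists_congr fun b₁ => exists_congr fun x => exists_congr fun b₂ => and_congr_right fun _ => ?_
  rw [← LatticeSym.oReach_examined_map_iff (ψ := ψ) 𝒞.seeds ω (ψ.σ.symm ![x, 0]),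
    ← LatticeSym.dReach_examined_map_iff (ψ := ψ) 𝒞.seeds ω (ψ.σF.symm ![b₁, 0]),
    ← LatticeSym.dReach_examined_map_iff (ψ := ψ) 𝒞.seeds ω (ψ.σF.symm ![b₂, 0]),
    ← LatticeSym.mem_examined_map_iff (ψ := ψ) 𝒞.seeds ω (ψ.edgeEquiv.symm (bottomEdge b₁)),
    ← LatticeSym.mem_examined_map_iff (ψ := ψ) 𝒞.seeds ω (ψ.edgeEquiv.symm (bottomEdge b₂)),
    ← ψ.mem_relabel_iff ω (ψ.edgeEquiv.symm (bottomEdge b₁)),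
    ← ψ.mem_relabel_iff ω (ψ.edgeEquiv.symm (bottomEdge b₂))]
  simp only [Equiv.apply_symm_apply]

/-! ### The bound -/

/-- **The bad patterns at an oriented window have probability at most `16 · P(threeArm)`**: the
standard bound for the transported datum and the invariance of `P_{1/2}` under the symmetry.
[cite: SchrammSmirnov2011, §4, proof of Prop. 4.1 with Lemma 6.2] -/
theorem real_patternAt_le {j : ℤ} {m R₁ : ℕ} (hW : (𝒞.map ψ).CleanWindow j m R₁) {R : ℕ} (hR : R + m + 1 ≤ R₁) :
    (bondPercolation (zdGraph 2) half).real (𝒞.patternOneAt ψ j m ∪ 𝒞.patternTwoAt ψ j m) ≤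
      16 * (bondPercolation (zdGraph 2) half).real (threeArm j m R) := by
  rw [patternOneAt, patternTwoAt, ← Set.preimage_union, ψ.real_preimage_relabel]
  exact real_patternOne_union_patternTwo_le hW hR

end CollarDatum

end Seeded

end Literature.Probability.Percolation
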